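import Literature.NumberTheory.LFunctions.LevelOneCentralValuesWeightAspect
import HarnessLib

/-!
# Balkanova–Frolenkov 2021, Theorem 8.8 AS TYPED (`balkanovaFrolenkov2021_theorem88`) is false —
# a formal refutation; the faithful rendering `balkanovaFrolenkov2021_theorem88'` is inhabited

Topic `Literature/NumberTheory/LFunctions` (namespace `Literature.NumberTheory.LFunctions`, objects in
the sub-namespace `LevelOneCentralValues`); companion of `LevelOneCentralValuesWeightAspect.lean`,
which vendors O. Balkanova, D. Frolenkov, *Moments of `L`-functions and the Liouville–Green method*,
J. Eur. Math. Soc. 23 (2021) 1333–1380 = arXiv:1610.03465 [BalkanovaFrolenkov2021], §§1, 7, 8.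
PROOF-ONLY module (D-0014/D-0026, kernel lane): theorems, no definitions, no named facts. Cell
`landau-siegel` §C, harvest row T-023 ERRATUM (2026-08-27; misstatement protocol).

That file types **Theorem 8.8** (the weight-averaged `1/2 − ε` harmonic proportion of level-one
primitive forms with `L_f(1/2) ≥ (log k)⁻²`; arXiv v3 TeX l. 2282–2290, held chunk p0021:L59–L66) over
the §7 weight test functions `IsWeightTest h` (`h ∈ C₀^∞(ℝ⁺)`, `h ≥ 0`, `tsupport h ⊆ [θ₁, θ₂]`,
`0 < θ₁ < θ₂`; (7.1), p0017:L3–L9) with `H = weightMass h = ∫ h` ((7.2), p0017:L11–L13). The source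
divides by `H` (`4/(HK)` in the display of Theorem 8.8, `H₁/H` in Lemma 7.1): `H > 0`, i.e. `h ≢ 0`, is
its standing implicit hypothesis. The typed predicate `IsWeightTest` admits `h ≡ 0`, so the rendering
`balkanovaFrolenkov2021_theorem88` (no `0 < H` binder) asserts, for `h ≡ 0`, `1/2 − ε ≤ 4/(0·K)·0 = 0`
— false. This file **proves** `¬ balkanovaFrolenkov2021_theorem88` (so the defective named fact can
never be discharged or relied upon) and records that the hypothesis class of the faithful rendering
`balkanovaFrolenkov2021_theorem88'` (the old display with the single extra binder `0 < weightMass h`)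
is inhabited: a smooth bump supported in `[1, 3]` is a §7 test function with `H > 0`.

## Content

* `LevelOneCentralValues.isWeightTest_zero` — `h ≡ 0` satisfies `IsWeightTest` (the gap).
* `LevelOneCentralValues.weightMass_zero` — `weightMass 0 = 0`.
* `LevelOneCentralValues.not_balkanovaFrolenkov2021_theorem88 : ¬ balkanovaFrolenkov2021_theorem88` — PROVED
  (same namespace as the fact; witness
  `h ≡ 0`, `ε = 1/4`, `K = max K₀ 1`); `balkanovaFrolenkov2021_theorem88_false` — the same under the
  tree's other conventional name.
* `LevelOneCentralValues.exists_isWeightTest_weightMass_pos` — some `h` has `IsWeightTest h` and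
  `0 < weightMass h` (Mathlib's `ContDiffBump` centred at `2` with radii `1/2 < 1`): the primed fact
  quantifies over a non-empty class.

Witness and scratch certificate by the §C reader seat ls-lit-r7 (cell bus 2026-08-27T02:40:27Z,
`HOME/ls-lit-r7/NotThm88.scratch.lean` sha16 7099fa01d090bad1), filed by the owner of the statement file
on the sub-cell lead's ruling (02:46:23Z). Nothing here is a claim about Landau–Siegel zeros.

## References

* [BalkanovaFrolenkov2021] O. Balkanova, D. Frolenkov, *Moments of `L`-functions and the
  Liouville–Green method*, J. Eur. Math. Soc. 23 (2021), no. 4, 1333–1380; arXiv:1610.03465 v3 —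
  §7 (7.1)–(7.2) (held p0017:L3–L13), Theorem 8.8 (TeX l. 2282–2290; held p0021:L59–L66, proof
  L68–L92).

«The programme SEARCHES and TYPES; no claim about Landau–Siegel zeros, Theorems 1–2 of
arXiv:2211.02515 or a repaired Margin232 until a kernel theorem says so.»
-/

noncomputable section

open scoped ContDiff MatrixGroups
open MeasureTheory

namespace Literature.NumberTheory.LFunctions

namespace LevelOneCentralValues

/-! ### The gap: `h ≡ 0` is admitted by `IsWeightTest` -/

/-- The zero function is a §7 weight test function in the typed sense (`tsupport 0 = ∅`).
[cite: BalkanovaFrolenkov2021, §7 (7.1)] -/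
theorem isWeightTest_zero : IsWeightTest (fun _ : ℝ => (0 : ℝ)) := by
  refine ⟨contDiff_const, fun _ => le_rfl, 1, 2, one_pos, by norm_num, ?_⟩
  intro y hy
  have h : tsupport (fun _ : ℝ => (0 : ℝ)) = ∅ := by
    rw [tsupport, Function.support]
    simp
  rw [h] at hy
  exact hy.elim

/-- `H = ∫ 0 = 0` for `h ≡ 0`. [cite: BalkanovaFrolenkov2021, §7 (7.2)] -/
theorem weightMass_zero : weightMass (fun _ : ℝ => (0 : ℝ)) = 0 := by
  simp [weightMass]

/-! ### The faithful rendering quantifies over a non-empty class -/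

/-- A §7 test function with `H > 0` exists: the smooth bump `ContDiffBump (2 : ℝ)` with inner/outer
radii `1/2 < 1` is `C^∞`, non-negative, has `tsupport = [1, 3]`, and positive integral.
[cite: BalkanovaFrolenkov2021, §7 (7.1)–(7.2)] -/
theorem exists_isWeightTest_weightMass_pos : ∃ h : ℝ → ℝ, IsWeightTest h ∧ 0 < weightMass h := by
  let b : ContDiffBump (2 : ℝ) := ⟨1 / 2, 1, by norm_num, by norm_num⟩
  refine ⟨b, ⟨b.contDiff, fun y => b.nonneg, 1, 3, one_pos, by norm_num, ?_⟩, ?_⟩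
  · rw [b.tsupport_eq]
    intro y hy
    rw [Metric.mem_closedBall, Real.dist_eq] at hy
    have hr : b.rOut = 1 := rfl
    rw [hr] at hy
    constructor <;> linarith [abs_le.mp hy]
  · exact b.integral_pos

/-! ### The refutation -/

/-- **As typed, Theorem 8.8 is false**: `IsWeightTest` admits `h ≡ 0`, for which `weightMass h = 0`,
`4/(0·K) = 0` and the typed conclusion reads `1/2 − ε ≤ 0`; take `ε = 1/4`, `K = max K₀ 1`. The
faithful statement is `balkanovaFrolenkov2021_theorem88'` (binder `0 < weightMass h`).
[cite: BalkanovaFrolenkov2021, Theorem 8.8 with §7 (7.2)] -/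
theorem not_balkanovaFrolenkov2021_theorem88 : ¬ balkanovaFrolenkov2021_theorem88 := by
  intro h
  obtain ⟨K₀, hK⟩ := h (fun _ => 0) isWeightTest_zero (1 / 4) (by norm_num)
  have := hK (max K₀ 1) (le_max_left _ _)
  rw [weightMass_zero] at this
  simp at this
  linarith

/-- `¬ balkanovaFrolenkov2021_theorem88`, under the `_false` name. [cite: BalkanovaFrolenkov2021, Theorem 8.8] -/
theorem balkanovaFrolenkov2021_theorem88_false : ¬ balkanovaFrolenkov2021_theorem88 :=
  not_balkanovaFrolenkov2021_theorem88

end LevelOneCentralValues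

end Literature.NumberTheory.LFunctions

end
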